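import Literature.AlgebraicGeometry.Frobenioids.NumberFieldLocalizationApplication
import Literature.AlgebraicGeometry.Frobenioids.BaseCategoryTheoreticityDefs
import HarnessLib

/-!
# Frobenioids II, Proposition 1.5 (iv): the Frobenius-slim clause; Prop. 1.5 at Example 1.4's `E₀ → P₀`

Mochizuki, *The geometry of Frobenioids II: poly-Frobenioids*, Kyushu J. Math. **62** (2008)
401–460, §1, Proposition 1.5, author's text (kurims `paper:url-4322d76898e0`) pp. 13–15
[cite: MochizukiFrdII2008, Prop. 1.5 (iv) p.14].  PROOF-ONLY companion of the statement files
`NumberFieldLocalizations.lean`, `NumberFieldLocalizationsAut.lean`, `NumberFieldLocalizationsMono.lean`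
(abc-iut-L1-t8) and of the assembly glue `NumberFieldLocalizationsGlue.lean`; sub-DAG W1 of
`plan/L1/DISCHARGE-L1.md` §0 (abc-iut-L1-lead), rows P15-L04c and P15-L10 of the cut
`SUBDAG-FrdII-Prop15.md` (seat abc-iut-w5-d174).  No definition, no named fact.

**Printed text (p. 14 l.3–11).** "(iv) If `E ∈ Ob(E)` projects to an object `P ∈ Ob(P)`, then we have
natural bijections `Aut(P_P → P) ⥲ Aut(E_E → P)`; `Aut(E_E → E) ⥲ Aut(E_E → P)` [induced by composition
with the natural functors `E → P`, `E_E → P_P`]. In particular, `P` is slim if and only if `E` is; `P` is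
Frobenius-slim if and only if `E` is."

**Contents.**
* `StandardFrobenioid.factors_degHom_of_injective` — the group-theoretic transport used by the
  Frobenius-slim clause: if `ι : A → B` is an injective homomorphism and every `𝔽 → B` through `ι`
  factors through `𝔽 ↠ N_{≥1}`, then so does every `𝔽 → A` (via the section `N_{≥1} → 𝔽`).
* `NFLoc.isFrobeniusSlim_of_isFrobeniusSlim_fst` — Prop. 1.5 (iv), last clause, the direction
  "`P` Frobenius-slim ⇒ `E` Frobenius-slim" (the direction consumed by [FrdII] Ex. 1.4 (iii) and
  §4–§5), PROVED for an abstract `π : E₀ ⥤ P₀` that is faithful, essentially surjective and satisfies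
  the reconstruction bijection of (i) — exactly as the typer's `NFLoc.isSlim_of_isSlim_fst`: an
  `𝔽`-action on `E_E → E` maps injectively (`autWhiskerToP_injective`) into
  `Aut(E_E → P) ≅ Aut(P_P → P)` (`autPostToP_bijective`; the injective composite homomorphism is
  `NFLoc.exists_monoidHom_aut_injective`), where it factors through `N_{≥1}`.
  The typer recorded this clause as "not typed here (TODO-merge)" pending abc-iut-L1-t3's
  `IsFrobeniusSlim` ([FrdI] Def. 3.1 (i), `BaseCategoryTheoreticityDefs.lean`), now in the tree.
* `NFLocCat.prop15_*_holds` — Prop. 1.5 (i)–(vi), the Frobenius-slim clause of (iv) and the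
  factorisation clause of (ix) for the PRINTED functor `E₀ → P₀` of Example 1.4 (`NFLocCat.toP₀ G D`,
  `G = Gal(F̃/F)` profinite, `D = D_v`), with EVERY assembly obligation of
  `NumberFieldLocalizationsGlue.lean` discharged by the tree's theorems (`toP₀Faithful_holds`,
  `toP₀ArrowwiseEssSurj_holds`, `toP₀EssSurj_of_profinite`, `toP₀HomReconstruction_holds`,
  `eTotallyEpimorphic_holds`, `pHasTrivialFactorizations_holds`; seats abc-iut-L1-d9 / -d4 / -t8):
  hypothesis-free closers over `[CompactSpace G] [TotallyDisconnectedSpace G]`.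

NOT here (recorded neutrally, no side taken): the converse directions "`E` slim ⇒ `P` slim",
"`E` Frobenius-slim ⇒ `P` Frobenius-slim" and the surjectivity of the second map
`Aut(E_E → E) → Aut(E_E → P)` are the typer's erratum candidate E2 (`NumberFieldLocalizationsAut.lean`,
module docstring; RULING P1) and are neither typed nor proved.  Refereed pre-IUT material; nothing
here bears on [IUTchIII] Cor. 3.12; typed ≠ proved elsewhere, here every statement is a theorem.
-/

namespace Literature.AlgebraicGeometry.Frobenioids

open CategoryTheory

universe v₀ v₁ v₂ u₀ u₁ u₂

/-! ### Transport of "factors through `𝔽 ↠ N_{≥1}`" along an injective homomorphism -/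

namespace StandardFrobenioid

/-- `degHom ∘ degSection = id`: the section `n ↦ (0, n)` splits `𝔽 ↠ N_{≥1}`.
[cite: MochizukiFrdI2008, Def. 1.1 (iii) p.20] -/
theorem degHom_degSection (n : ℕ+) : degHom (degSection n) = n := rfl

/-- If `ι : A → B` is an injective homomorphism of groups and the composite `ι ∘ f` of a homomorphism
`f : 𝔽 → A` factors through the natural surjection `𝔽 ↠ N_{≥1}`, then `f` itself factors through
`𝔽 ↠ N_{≥1}` (namely as `(f ∘ δ) ∘ deg`, `δ` the section `n ↦ (0, n)`).  This is the step "maps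
injectively into a group in which every `𝔽`-action factors through `N_{≥1}`" of FrdII Prop. 1.5 (iv).
[cite: MochizukiFrdII2008, Prop. 1.5 (iv) p.14] -/
theorem factors_degHom_of_injective {A : Type u₁} {B : Type u₂} [Group A] [Group B] (ι : A →* B)
    (hι : Function.Injective ι) (f : StandardFrobenioid →* A)
    (hB : ∃ g : ℕ+ →* B, ι.comp f = g.comp degHom) :
    ∃ g : ℕ+ →* A, f = g.comp degHom := by
  obtain ⟨g, hg⟩ := hB
  refine ⟨f.comp degSection, MonoidHom.ext fun x => hι ?_⟩
  have h1 : ι (f x) = g (degHom x) := by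
    simpa only [MonoidHom.comp_apply] using DFunLike.congr_fun hg x
  have h2 : ι (f (degSection (degHom x))) = g (degHom (degSection (degHom x))) := by
    simpa only [MonoidHom.comp_apply] using DFunLike.congr_fun hg (degSection (degHom x))
  rw [MonoidHom.comp_apply, MonoidHom.comp_apply, h1, h2, degHom_degSection]

end StandardFrobenioid

/-- Frobenius-slimness at one object transports along an injective homomorphism of the automorphism
groups of the forgetful functors: if `Aut(E_X → E) ↪ Aut(P_A → P)` and every `𝔽 → Aut(P_A → P)` factors
through `N_{≥1}`, then so does every `𝔽 → Aut(E_X → E)`. [cite: MochizukiFrdII2008, Prop. 1.5 (iv) p.14] -/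
theorem IsFrobeniusSlim.factors_of_injective {P : Type u₂} [Category.{v₂} P] (hP : IsFrobeniusSlim P)
    {H : Type u₁} [Group H] (A : P) (ι : H →* Aut (Over.forget A)) (hι : Function.Injective ι)
    (f : StandardFrobenioid →* H) : ∃ g : ℕ+ →* H, f = g.comp StandardFrobenioid.degHom :=
  StandardFrobenioid.factors_degHom_of_injective ι hι f (hP.factors A (ι.comp f))

namespace NFLoc

section FiberProduct

variable {P₀ : Type u₀} [Category.{v₀} P₀] {E₀ : Type u₁} [Category.{v₁} E₀]
  {P : Type u₂} [Category.{v₂} P] {F : P ⥤ P₀} {π : E₀ ⥤ P₀}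

/-- The composite `Aut(E_E → E) → Aut(E_E → P) ≅ Aut(P_P → P)` of the second map of FrdII Prop. 1.5
(iv) with the inverse of the first bijection is an injective homomorphism of groups (faithfulness of
`E → P`, `autWhiskerToP_injective`, and the first bijection `autPostToP_bijective`).
[cite: MochizukiFrdII2008, Prop. 1.5 (iv) p.14] -/
theorem exists_monoidHom_aut_injective [π.Faithful] [π.EssSurj] (h : HomReconstruction π)
    (X : Loc F π) :
    ∃ ι : Aut (Over.forget X) →* Aut (Over.forget X.fst), Function.Injective ι ∧
      ∀ β, autPostToP X (ι β) = autWhiskerToP X β := by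
  let e : Aut (Over.forget X.fst) ≃* Aut (Over.forget X ⋙ toP F π) :=
    MulEquiv.ofBijective (autPostToP X) (autPostToP_bijective h X)
  refine ⟨e.symm.toMonoidHom.comp (autWhiskerToP X),
    e.symm.injective.comp (autWhiskerToP_injective X), fun β => ?_⟩
  change e (e.symm (autWhiskerToP X β)) = autWhiskerToP X β
  exact e.apply_symm_apply _

/-- **FrdII Prop. 1.5 (iv), Frobenius-slim clause, the consumed direction (PROVED):** if `P` is
Frobenius-slim ([FrdI] Def. 3.1 (i): every `𝔽 → Aut(P_A → P)` factors through `𝔽 ↠ N_{≥1}`), then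
so is `E = P ×_{P₀} E₀` — for a faithful, essentially surjective `π : E₀ → P₀` with the reconstruction
bijection of (i).  Printed: "`P` is Frobenius-slim if and only if `E` is" (p. 14); the converse is part
of erratum candidate E2 and is not asserted. [cite: MochizukiFrdII2008, Prop. 1.5 (iv) p.14] -/
theorem isFrobeniusSlim_of_isFrobeniusSlim_fst [π.Faithful] [π.EssSurj] (h : HomReconstruction π)
    (hP : IsFrobeniusSlim P) : IsFrobeniusSlim (Loc F π) := by
  refine ⟨fun X f => ?_⟩
  obtain ⟨ι, hι, -⟩ := exists_monoidHom_aut_injective h X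
  exact hP.factors_of_injective X.fst ι hι f

end FiberProduct

end NFLoc

/-! ### Proposition 1.5 at the printed functor `E₀ → P₀` of Example 1.4, obligations discharged -/

namespace NFLocCat

universe v' u' u

variable {G : Type u} [Group G] [TopologicalSpace G] [IsTopologicalGroup G] [CompactSpace G]
  [TotallyDisconnectedSpace G] (D : Subgroup G) {P : Type u'} [Category.{v'} P] (Φ : P ⥤ PCat G D)

/-- **FrdII Prop. 1.5 (i)** for Example 1.4's `E₀ → P₀`, `G` profinite, NO residual hypothesis: `E → P`
is faithful and arrow-wise essentially surjective, and `P` is reconstructed from `E` by inverting the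
`P`-isomorphisms. [cite: MochizukiFrdII2008, Prop. 1.5 (i) p.13] -/
theorem prop15_i_holds :
    (NFLoc.toP Φ (toP₀ G D)).Faithful ∧ IsArrowwiseEssSurj (NFLoc.toP Φ (toP₀ G D)) ∧
      NFLoc.HomReconstruction (NFLoc.toP Φ (toP₀ G D)) :=
  prop15_i Φ (toP₀Faithful_holds D) (toP₀ArrowwiseEssSurj_holds D) (toP₀HomReconstruction_holds G D)

/-- **FrdII Prop. 1.5 (ii)** for Example 1.4's `E₀ → P₀`, `G` profinite, NO residual hypothesis: `P` is
connected iff `E` is. [cite: MochizukiFrdII2008, Prop. 1.5 (ii) p.13] -/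
theorem prop15_ii_holds : IsConnected P ↔ IsConnected (NFLoc.Loc Φ (toP₀ G D)) :=
  prop15_ii Φ (toP₀EssSurj_of_profinite G D) (toP₀HomReconstruction_holds G D)

/-- **FrdII Prop. 1.5 (iii)** for Example 1.4's `E₀ → P₀`, `G` profinite, NO residual hypothesis: `P` is
totally epimorphic iff `E` is. [cite: MochizukiFrdII2008, Prop. 1.5 (iii) p.14] -/
theorem prop15_iii_holds : IsTotallyEpimorphic P ↔ IsTotallyEpimorphic (NFLoc.Loc Φ (toP₀ G D)) :=
  prop15_iii Φ (toP₀Faithful_holds D) (toP₀EssSurj_of_profinite G D) (toP₀HomReconstruction_holds G D)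
    (eTotallyEpimorphic_holds D)

/-- **FrdII Prop. 1.5 (iv)** for Example 1.4's `E₀ → P₀`, `G` profinite, NO residual hypothesis, the
clauses that are theorems of the tree: the first bijection `Aut(P_P → P) ⥲ Aut(E_E → P)`, injectivity of
the second map `Aut(E_E → E) → Aut(E_E → P)`, "`P` slim ⇒ `E` slim" and "`P` Frobenius-slim ⇒ `E`
Frobenius-slim".  (The remaining printed clauses are erratum candidate E2, not asserted.)
[cite: MochizukiFrdII2008, Prop. 1.5 (iv) p.14] -/
theorem prop15_iv_holds :
    (∀ X : NFLoc.Loc Φ (toP₀ G D), Function.Bijective (NFLoc.autPostToP X)) ∧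
      (∀ X : NFLoc.Loc Φ (toP₀ G D), Function.Injective (NFLoc.autWhiskerToP X)) ∧
      (IsSlim P → IsSlim (NFLoc.Loc Φ (toP₀ G D))) ∧
      (IsFrobeniusSlim P → IsFrobeniusSlim (NFLoc.Loc Φ (toP₀ G D))) := by
  haveI : (toP₀ G D).Faithful := toP₀Faithful_holds D
  haveI : (toP₀ G D).EssSurj := toP₀EssSurj_of_profinite G D
  have hR : NFLoc.HomReconstruction (toP₀ G D) := toP₀HomReconstruction_holds G D
  exact ⟨fun X => NFLoc.autPostToP_bijective hR X, fun X => NFLoc.autWhiskerToP_injective X,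
    fun hP => NFLoc.isSlim_of_isSlim_fst hR hP, fun hP => NFLoc.isFrobeniusSlim_of_isFrobeniusSlim_fst hR hP⟩

/-- **FrdII Prop. 1.5 (v)** for Example 1.4's `E₀ → P₀`, `G` profinite, NO residual hypothesis: a
morphism of `E` is a monomorphism (resp. fiberwise surjective; an FSM-morphism) iff its projection to `P`
is. [cite: MochizukiFrdII2008, Prop. 1.5 (v) p.14] -/
theorem prop15_v_holds {X Y : NFLoc.Loc Φ (toP₀ G D)} (φ : X ⟶ Y) :
    (Mono φ ↔ Mono φ.fst) ∧ (IsFiberwiseSurjective φ ↔ IsFiberwiseSurjective φ.fst) ∧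
      (IsFSM φ ↔ IsFSM φ.fst) :=
  prop15_v Φ (toP₀Faithful_holds D) (toP₀EssSurj_of_profinite G D) (toP₀HomReconstruction_holds G D) φ

/-- **FrdII Prop. 1.5 (vi)** for Example 1.4's `E₀ → P₀`, `G` profinite, NO residual hypothesis: if `P`
is of FSM-type, a morphism of `E` is a `P`-isomorphism iff it is an FSM-morphism.
[cite: MochizukiFrdII2008, Prop. 1.5 (vi) p.14] -/
theorem prop15_vi_holds (hP : IsOfFSMType P) {X Y : NFLoc.Loc Φ (toP₀ G D)} (φ : X ⟶ Y) :
    NFLoc.IsProjIso (NFLoc.toP Φ (toP₀ G D)) φ ↔ IsFSM φ :=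
  prop15_vi Φ (toP₀Faithful_holds D) (toP₀EssSurj_of_profinite G D) (toP₀HomReconstruction_holds G D)
    hP φ

omit [CompactSpace G] [TotallyDisconnectedSpace G] in
/-- **FrdII Prop. 1.5 (ix)**, factorisation clause, for Example 1.4's `E₀ → P₀` (any topological group
`G`),
NO residual hypothesis beyond the printed "`D_v` trivial or of prime order": every factorisation
`φ_P = α_P ∘ β_P` in `P` lifts to `φ_E = α_E ∘ β_E` in `E`. [cite: MochizukiFrdII2008, Prop. 1.5 (ix) p.14] -/
theorem prop15_ix_holds (hD : D = ⊥ ∨ (Nat.card D).Prime) {X Y : NFLoc.Loc Φ (toP₀ G D)} (φ : X ⟶ Y)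
    {M : P} (β : X.fst ⟶ M) (α : M ⟶ Y.fst) (hφ : β ≫ α = φ.fst) :
    ∃ (X₂ : ECat G D) (γ : Φ.obj M ≅ (toP₀ G D).obj X₂) (βE : X ⟶ CFP.mk M X₂ γ)
      (αE : CFP.mk M X₂ γ ⟶ Y), βE ≫ αE = φ ∧ βE.fst = β ∧ αE.fst = α :=
  prop15_ix Φ (pHasTrivialFactorizations_holds G D) hD φ β α hφ

end NFLocCat

end Literature.AlgebraicGeometry.Frobenioids
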